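import Summits.ResolutionOfSingularities.ResolutionOfSingularities.Theorems.FrobeniusClosingSteerMemberDerivationsResidue
import Summits.ResolutionOfSingularities.ResolutionOfSingularities.Theorems.FrobeniusClosingSteerMemberDerivationFrame
import Literature.AlgebraicGeometry.Resolution.RegularSystemOfParameters
import HarnessLib

/-!
# Crux `Steer` (stmt-ResolutionOfSingularities-16345), chain W4.1: (L7) members have ENOUGH DERIVATIONS, part 3 —
# THE ASSEMBLY: `HasCleaningDerivations` for every regular local ring essentially of finite type over a perfect field
# (Theses-free, def-free; res-D-pv-003's binder `hL7` verbatim)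

OURS (campaign `res-hironaka`, rung L ★L-G4, slot W4.1; statements about the route's own objects; NOT statements of the
manuscript under review [claim: Hironaka2017, status: under-review]; AI review is weaker than expert review). Seat
res-D-pv-004 (AS res-L0-w41-stub-10); object (L7) of res-L0-w41-plan-1 RULING 84b; signature = res-D-pv-003's
preferred shape (HOME/STATUS 2026-08-27T11:01:52Z), accepted in RULING 90's window.

`hasCleaningDerivations_of_essFiniteType_perfect`: for a field `k` of characteristic `p`, PERFECT, a field `K ⊇ k` and a
REGULAR LOCAL subring `S ⊆ K` carrying a `k`-algebra structure (compatible with `K`'s) for which `S` is ESSENTIALLY OF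
FINITE TYPE over `k` — the transversal germs `(R i)_P` of res-D-pv-003's Θ1♭ packaging (`GeoDict.essFiniteType_of_locChar`)
— the member binder `H = HasCleaningDerivations p S f g` of res-L0-w41-strat-2's §σ2.26 v2 holds for ALL `f, g`.
Assembly of: res-L0-w41-stub-4's DUAL `p`-BASIS FRAME `MemberDerivationFrame.exists_frame_int` ((L7-Ω): a regular
system of parameters with dual derivations, lifts of a `p`-basis of the residue field with dual logarithmic derivations,
Stacks 00TV + Matsumura 26.5/30.6) + part 2 `hasCleaningDerivations_of_dual_frame_subring` (residue kernel-exactness +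
part 1's graded Taylor lemma). The compatibility hypothesis `hcompat` of the agreed signature is carried VERBATIM but is
not needed by the proof (any `k`-structure making `S` essentially of finite type suffices); `…_perfect'` drops it.

No Theses file is imported; nothing here is a route item or a registration. [cite: Matsumura1987, Thm. 17.10, Thm. 26.5,
Thm. 30.6] [cite: StacksProject, Tag 00TV]
-/

noncomputable section

-- `Summit.<S>.<S>.…` duplicates the summit name by design (single-problem summit).
set_option linter.dupNamespace false

open IsLocalRing

namespace Summit.ResolutionOfSingularities.ResolutionOfSingularities.Theorems.SwitchingDichotomy.MemberDerivations

open Literature.AlgebraicGeometry.Resolution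

/-- **(L7) — members have ENOUGH DERIVATIONS** (res-L0-w41-plan-1 RULING 84b; the member binder `H` of K♭ v2.2), without
the compatibility hypothesis: a regular local subring `S` of a field `K`, essentially of finite type over a PERFECT field
`k` of characteristic `p` (for any `k`-algebra structure on `S`), satisfies `HasCleaningDerivations p S f g` for all
`f g : S`. [cite: Matsumura1987, Thm. 17.10, Thm. 26.5, Thm. 30.6] -/
theorem hasCleaningDerivations_of_essFiniteType_perfect' (p : ℕ) [Fact p.Prime] (k : Type) [Field k] [CharP k p]
    [PerfectField k] {K : Type} [Field K] (S : Subring K) [IsRegularLocalRing S] [Algebra k S]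
    [Algebra.EssFiniteType k S] (f g : S) : HasCleaningDerivations p S f g := by
  haveI : CharP S p := charP_of_injective_algebraMap (algebraMap k S).injective p
  haveI : CharP K p := charP_of_injective_ringHom S.subtype_injective p
  -- a regular system of parameters
  obtain ⟨x, hx⟩ := exists_regularSystemOfParameters (R := S)
  -- res-L0-w41-stub-4's dual `p`-basis frame on it
  obtain ⟨e, u, δ, dx, du, hgen, hδu, hδker, hdx, -, hdux, hduu⟩ :=
    MemberDerivationFrame.exists_frame_int p k S rfl x hx
  exact hasCleaningDerivations_of_dual_frame_subring p S rfl x hx u δ dx du hgen hδu hδker hdx hdux hduu f g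

/-- **(L7) — members have ENOUGH DERIVATIONS, res-D-pv-003's binder `hL7` VERBATIM** (HOME/STATUS 2026-08-27T11:01:52Z;
res-L0-w41-plan-1 RULINGs 84b/90): for `k ⊆ K` fields, `k` PERFECT of characteristic `p`, and a REGULAR LOCAL subring
`S ⊆ K` with a `k`-structure compatible with `K`'s making it ESSENTIALLY OF FINITE TYPE over `k`, the member binder
`HasCleaningDerivations p S f g` holds for all `f g`. (`hcompat` is carried for the consumer's convenience and unused.)
[cite: Matsumura1987, Thm. 17.10, Thm. 26.5, Thm. 30.6] -/
theorem hasCleaningDerivations_of_essFiniteType_perfect {k K : Type} [Field k] [Field K] [Algebra k K] (p : ℕ)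
    [Fact p.Prime] [CharP k p] [PerfectField k] (S : Subring K) [IsRegularLocalRing S] [Algebra k S]
    (hcompat : ∀ c : k, ((algebraMap k S c : S) : K) = algebraMap k K c) [Algebra.EssFiniteType k S] (f g : S) :
    HasCleaningDerivations p S f g :=
  have _ := hcompat
  hasCleaningDerivations_of_essFiniteType_perfect' p k S f g

end Summit.ResolutionOfSingularities.ResolutionOfSingularities.Theorems.SwitchingDichotomy.MemberDerivations

end
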